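import Literature.AlgebraicGeometry.Frobenioids.PerfectionPreSteps
import HarnessLib

/-!
# Frobenioids I, §3/§5: endomorphisms of an object `(A, n)` of the perfection `C^pf`, and `O^▷((A, n))`

Mochizuki, *The geometry of Frobenioids I: the general theory*, Kyushu J. Math. **62** (2008)
293–400, Definition 3.1 (ii)/(iii) pp. 56–57 (the perfection `C^pf`), Proposition 3.2 (i) p. 58 (its
pre-Frobenioid structure) and Proposition 5.5 (i) p. 104 ("the natural functor `C → C^pf` determines a
natural isomorphism `O^▷(A)^pf ⥲ O^▷(A^pf)`") [cite: MochizukiFrdI2008, Prop. 5.5 (i) p.104].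

Companion of the `C^pf` chain (`Perfection*.lean`; node FrdI:Prop5.5(i), sub-nodes P55-L01/L02 of the
cell's SUBDAG-FrdI-Thm51iv-Prop55).  By Def. 3.1 (ii)/(iii), `End_{C^pf}((A, n)) = lim_→ End_C(A^{(c)})`,
the inductive limit over the DIAGONAL levels `(c, c)` (an endomorphism level `(a, b)` of `(A, n)` has
`n·a = n·b`, i.e. `a = b`) along the Prop. 1.10 (i) transport `liftLevel`.  This file makes that limit
usable:

* `endClass X c θ : X ⟶ X` — the class at the diagonal level `(c, c)` of an endomorphism `θ` of
  `X.obj^{(c)}`; composition at one level is composition in `C` (`endClass_comp`), transport does not change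
  the class (`endClass_liftLevel`), the classes are jointly surjective (`exists_endClass_eq`), with the
  inductive-limit equality criterion (`endClass_eq_iff`); packaged as homomorphisms of monoids
  `endClassHom X c : End_C(X.obj^{(c)}) →* End_{C^pf}(X)`;
* the dictionary for `O^▷`: `[θ] ∈ O^▷(X)` (base-identity and linear for the operations `Perfection.ops` of
  Prop. 3.2 (i)) iff `θ ∈ O^▷(X.obj^{(c)})` (`endClassHom_mem_iff`), so that `O^▷((A, n)) = lim_→ O^▷(A^{(c)})`,
  with the restricted homomorphisms `endSubmonoidClassHom X c : O^▷(X.obj^{(c)}) →* O^▷(X)`;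
(`O^▷(A)` as a commutative monoid — Remark 1.3.1 — is `PreFrobenioid.endCommMonoid F hF A` of `Prop55Sub.lean`,
used downstream in `PerfectionUnitsIsoFrTriv.lean`.)

DISCLOSURE.  Only `hF : IsFrobenioid F` is assumed (print's standing hypothesis "`C` of Frobenius-isotropic
type" for `C^pf`, Def. 3.1 (iii) p. 56, is not needed for this bookkeeping).  Multiplication in Mathlib's
`End A` is `f * g = g ≫ f`; `End.of`/`End.asHom` mediate between `End A` and `A ⟶ A`.
-/

namespace Literature.AlgebraicGeometry.Frobenioids

namespace PreFrobenioid

open CategoryTheory Opposite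

universe w v v' u u'

variable {D : Type u} [Category.{v} D] {Φ : Dᵒᵖ ⥤ CommMonCat.{w}}
  {C : Type u'} [Category.{v'} C] {F : C ⥤ ElemFrobenioid Φ}

namespace Perfection

variable {hF : IsFrobenioid F}

/-! ### Diagonal levels -/

/-- An endomorphism level `(a, b)` of `X = (A, n)` has `a = b` (`n·a = n·b`).
[cite: MochizukiFrdI2008, Def. 3.1 (iii) p.57] -/
theorem Level.a_eq_b {X : Perfection hF} (L : Level X X) : L.a = L.b := mul_left_cancel L.eq

/-- The diagonal level `(c, c)` of `X = (A, n)`; its representatives are the endomorphisms of `A^{(c)}`.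
[cite: MochizukiFrdI2008, Def. 3.1 (iii) p.57] -/
abbrev Level.diag (X : Perfection hF) (c : ℕ+) : Level X X := ⟨c, c, rfl⟩

/-- Every endomorphism level is a diagonal level. [cite: MochizukiFrdI2008, Def. 3.1 (iii) p.57] -/
theorem Level.eq_diag {X : Perfection hF} (L : Level X X) : L = Level.diag X L.a :=
  Level.ext rfl L.a_eq_b.symm

variable (X : Perfection hF)

/-! ### The class of an endomorphism of `A^{(c)}` -/

/-- The class `[θ] : X → X` in `C^pf` of an endomorphism `θ` of `X.obj^{(c)}`, at the diagonal level
`(c, c)`. [cite: MochizukiFrdI2008, Def. 3.1 (iii) p.57] -/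
noncomputable def endClass (c : ℕ+) (θ : frobPow hF X.obj c ⟶ frobPow hF X.obj c) : X ⟶ X :=
  Hom.mk ⟨Level.diag X c, θ⟩

/-- `endClass` unfolds to the class of the representative `((c, c), θ)`. [cite: MochizukiFrdI2008, Def. 3.1 (iii) p.57] -/
theorem endClass_def (c : ℕ+) (θ : frobPow hF X.obj c ⟶ frobPow hF X.obj c) :
    endClass X c θ = Hom.mk ⟨Level.diag X c, θ⟩ := rfl

/-- Transport does not change the class: `[(c', c'), liftLevel θ] = [(c, c), θ]`.
[cite: MochizukiFrdI2008, Def. 3.1 (ii) p.56] -/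
theorem endClass_liftLevel {c c' : ℕ+} (h : c ∣ c') (θ : frobPow hF X.obj c ⟶ frobPow hF X.obj c)
    (hd : degFr F (frobTrans hF X.obj h) = degFr F (frobTrans hF X.obj h)) :
    endClass X c' (liftLevel hF θ h h hd) = endClass X c θ :=
  Hom.mk_lift ⟨Level.diag X c, θ⟩ (Level.diag X c') ⟨h, h⟩

/-- Every endomorphism of `X` in `C^pf` is the class of an endomorphism of some `X.obj^{(c)}`.
[cite: MochizukiFrdI2008, Def. 3.1 (iii) p.57] -/
theorem exists_endClass_eq (f : X ⟶ X) :
    ∃ (c : ℕ+) (θ : frobPow hF X.obj c ⟶ frobPow hF X.obj c), endClass X c θ = f := by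
  obtain ⟨⟨⟨a, b, hab⟩, θ⟩, rfl⟩ := Hom.mk_surjective f
  obtain rfl : a = b := mul_left_cancel hab
  exact ⟨a, θ, rfl⟩

/-- The inductive-limit criterion: two classes coincide iff the representatives agree after transport to a
common diagonal level. [cite: MochizukiFrdI2008, Def. 3.1 (ii) p.56] -/
theorem endClass_eq_iff {c c' : ℕ+} (θ : frobPow hF X.obj c ⟶ frobPow hF X.obj c)
    (θ' : frobPow hF X.obj c' ⟶ frobPow hF X.obj c') :
    endClass X c θ = endClass X c' θ' ↔
      ∃ (c'' : ℕ+) (h : c ∣ c'') (h' : c' ∣ c''),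
        liftLevel hF θ h h rfl = liftLevel hF θ' h' h' rfl := by
  refine (Hom.mk_eq_mk (r := ⟨Level.diag X c, θ⟩) (s := ⟨Level.diag X c', θ'⟩)).trans ?_
  constructor
  · rintro ⟨⟨ma, mb, hm⟩, hr, hs, e⟩
    obtain rfl : ma = mb := mul_left_cancel hm
    exact ⟨ma, hr.1, hs.1, e⟩
  · rintro ⟨c'', h, h', e⟩
    exact ⟨Level.diag X c'', ⟨h, h⟩, ⟨h', h'⟩, e⟩

/-- Classes at one diagonal level compose in `C`: `[θ] ≫ [θ'] = [θ ≫ θ']`.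
[cite: MochizukiFrdI2008, Def. 3.1 (iii) p.57] -/
theorem endClass_comp (c : ℕ+) (θ θ' : frobPow hF X.obj c ⟶ frobPow hF X.obj c) :
    endClass X c θ ≫ endClass X c θ' = endClass X c (θ ≫ θ') := by
  let T : Level₃ X X X := ⟨c, c, c, rfl, rfl⟩
  have e := mk_compAt T ⟨Level.diag X c, θ⟩ ⟨Level.diag X c, θ'⟩ (Level.le_rfl _) (Level.le_rfl _)
  rw [endClass_def, endClass_def, endClass_def, mk_comp_mk, ← e]
  unfold compAt
  have e₁ : Level.lift (Level.diag X c) T.fst (Level.le_rfl _) θ = θ := Level.lift_rfl _ _ _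
  have e₂ : Level.lift (Level.diag X c) T.snd (Level.le_rfl _) θ' = θ' := Level.lift_rfl _ _ _
  rw [e₁, e₂]

/-- The class of an identity is the identity of `X`. [cite: MochizukiFrdI2008, Def. 3.1 (iii) p.57] -/
theorem endClass_id (c : ℕ+) : endClass X c (𝟙 (frobPow hF X.obj c)) = 𝟙 X := by
  have h := Hom.mk_lift (Rep.id X) (Level.diag X c) ⟨one_dvd c, one_dvd c⟩
  have e : Level.lift (Rep.id X).L (Level.diag X c) ⟨one_dvd c, one_dvd c⟩ (Rep.id X).hom =
      𝟙 (frobPow hF X.obj c) :=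
    liftLevel_id hF (one_dvd c) _
  rw [e] at h
  rw [id_eq_mk, ← h, endClass_def]

/-! ### The classes as homomorphisms of monoids `End_C(A^{(c)}) → End_{C^pf}((A, n))` -/

/-- `endClassHom X c : End_C(X.obj^{(c)}) →* End_{C^pf}(X)`, the class at the diagonal level `(c, c)` as a
homomorphism of monoids (Mathlib: `f * g = g ≫ f` in both `End`s). [cite: MochizukiFrdI2008, Def. 3.1 (iii) p.57] -/
noncomputable def endClassHom (c : ℕ+) : End (frobPow hF X.obj c) →* End X where
  toFun θ := End.of (endClass X c (End.asHom θ))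
  map_one' := endClass_id X c
  map_mul' θ θ' := (endClass_comp X c (End.asHom θ') (End.asHom θ)).symm

/-- `endClassHom X c θ = [θ]`. [cite: MochizukiFrdI2008, Def. 3.1 (iii) p.57] -/
theorem endClassHom_apply (c : ℕ+) (θ : End (frobPow hF X.obj c)) :
    endClassHom X c θ = End.of (endClass X c (End.asHom θ)) := rfl

/-- Transport does not change the class (homomorphism form). [cite: MochizukiFrdI2008, Def. 3.1 (ii) p.56] -/
theorem endClassHom_liftLevel {c c' : ℕ+} (h : c ∣ c') (θ : End (frobPow hF X.obj c))
    (hd : degFr F (frobTrans hF X.obj h) = degFr F (frobTrans hF X.obj h)) :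
    endClassHom X c' (End.of (liftLevel hF (End.asHom θ) h h hd)) = endClassHom X c θ :=
  endClass_liftLevel X h (End.asHom θ) hd

/-- Joint surjectivity of the `endClassHom X c`. [cite: MochizukiFrdI2008, Def. 3.1 (iii) p.57] -/
theorem exists_endClassHom_eq (f : End X) :
    ∃ (c : ℕ+) (θ : End (frobPow hF X.obj c)), endClassHom X c θ = f :=
  exists_endClass_eq X f

/-- The inductive-limit criterion (homomorphism form). [cite: MochizukiFrdI2008, Def. 3.1 (ii) p.56] -/
theorem endClassHom_eq_iff {c c' : ℕ+} (θ : End (frobPow hF X.obj c)) (θ' : End (frobPow hF X.obj c')) :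
    endClassHom X c θ = endClassHom X c' θ' ↔
      ∃ (c'' : ℕ+) (h : c ∣ c'') (h' : c' ∣ c''),
        liftLevel hF (End.asHom θ) h h rfl = liftLevel hF (End.asHom θ') h' h' rfl :=
  endClass_eq_iff X (End.asHom θ) (End.asHom θ')

/-! ### `O^▷((A, n)) = lim_→ O^▷(A^{(c)})` -/

/-- `[θ]` is linear (for the operations of `C^pf`) iff `θ` is linear. [cite: MochizukiFrdI2008, Prop. 3.2 (i) p.58] -/
theorem isLinear_endClass_iff (c : ℕ+) (θ : frobPow hF X.obj c ⟶ frobPow hF X.obj c) :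
    (ops hF).IsLinear (X := X) (Y := X) (endClass X c θ) ↔ IsLinear F θ :=
  isLinear_mk_iff _

/-- `[θ]` is a base-identity endomorphism of `X` iff `θ` is a base-identity endomorphism of `X.obj^{(c)}`:
`Base([θ]) = Base(frob) ≫ Base(θ) ≫ Base(frob)⁻¹`. [cite: MochizukiFrdI2008, Prop. 3.2 (i) p.58] -/
theorem isBaseIdentity_endClass_iff (c : ℕ+) (θ : frobPow hF X.obj c ⟶ frobPow hF X.obj c) :
    (ops hF).IsBaseIdentity (endClass X c θ) ↔ IsBaseIdentity F θ := by
  change Base F (frob hF X.obj c) ≫ Base F θ ≫ baseInvFrob hF X.obj c = 𝟙 _ ↔ Base F θ = 𝟙 _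
  constructor
  · intro h
    have h' := congrArg (fun k => baseInvFrob hF X.obj c ≫ k ≫ Base F (frob hF X.obj c)) h
    simp only [Category.assoc, baseInvFrob_base_frob, baseInvFrob_base_frob_assoc, Category.comp_id,
      Category.id_comp] at h'
    exact h'
  · intro h
    rw [h, Category.id_comp, base_frob_baseInvFrob]

/-- **`O^▷((A, n)) = lim_→ O^▷(A^{(c)})`**: the class `[θ]` lies in `O^▷(X)` (base-identity linear
endomorphisms of `X` for `Perfection.ops`) iff `θ ∈ O^▷(X.obj^{(c)})`.
[cite: MochizukiFrdI2008, Prop. 5.5 (i) p.104] -/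
theorem endClassHom_mem_iff (c : ℕ+) (θ : End (frobPow hF X.obj c)) :
    endClassHom X c θ ∈ (ops hF).endSubmonoid X ↔ θ ∈ endSubmonoid F (frobPow hF X.obj c) :=
  and_congr (isBaseIdentity_endClass_iff X c (End.asHom θ)) (isLinear_endClass_iff X c (End.asHom θ))

/-- Every element of `O^▷(X)` is the class of an element of some `O^▷(X.obj^{(c)})`.
[cite: MochizukiFrdI2008, Prop. 5.5 (i) p.104] -/
theorem exists_endClassHom_eq_of_mem {f : End X} (hf : f ∈ (ops hF).endSubmonoid X) :
    ∃ (c : ℕ+) (θ : End (frobPow hF X.obj c)), θ ∈ endSubmonoid F (frobPow hF X.obj c) ∧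
      endClassHom X c θ = f := by
  obtain ⟨c, θ, rfl⟩ := exists_endClassHom_eq X f
  exact ⟨c, θ, (endClassHom_mem_iff X c θ).mp hf, rfl⟩

/-- Transport preserves membership in `O^▷`: `liftLevel θ ∈ O^▷(A^{(c')})` iff `θ ∈ O^▷(A^{(c)})`.
[cite: MochizukiFrdI2008, Prop. 1.10 (i) p.34] -/
theorem liftLevel_mem_iff {c c' : ℕ+} (h : c ∣ c') (θ : End (frobPow hF X.obj c))
    (hd : degFr F (frobTrans hF X.obj h) = degFr F (frobTrans hF X.obj h)) :
    End.of (liftLevel hF (End.asHom θ) h h hd) ∈ endSubmonoid F (frobPow hF X.obj c') ↔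
      θ ∈ endSubmonoid F (frobPow hF X.obj c) := by
  rw [← endClassHom_mem_iff X c' (End.of (liftLevel hF (End.asHom θ) h h hd)), endClassHom_liftLevel,
    endClassHom_mem_iff]

/-- The restriction of `endClassHom X c` to `O^▷(X.obj^{(c)}) → O^▷(X)`.
[cite: MochizukiFrdI2008, Prop. 5.5 (i) p.104] -/
noncomputable def endSubmonoidClassHom (c : ℕ+) :
    endSubmonoid F (frobPow hF X.obj c) →* (ops hF).endSubmonoid X where
  toFun θ := ⟨endClassHom X c θ.1, (endClassHom_mem_iff X c θ.1).mpr θ.2⟩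
  map_one' := Subtype.ext (endClassHom X c).map_one
  map_mul' θ θ' := Subtype.ext ((endClassHom X c).map_mul θ.1 θ'.1)

/-- `(endSubmonoidClassHom X c θ).1 = endClassHom X c θ.1`. [cite: MochizukiFrdI2008, Prop. 5.5 (i) p.104] -/
@[simp] theorem endSubmonoidClassHom_coe (c : ℕ+) (θ : endSubmonoid F (frobPow hF X.obj c)) :
    (endSubmonoidClassHom X c θ).1 = endClassHom X c θ.1 := rfl

/-- Joint surjectivity of the `endSubmonoidClassHom X c` onto `O^▷(X)`.
[cite: MochizukiFrdI2008, Prop. 5.5 (i) p.104] -/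
theorem exists_endSubmonoidClassHom_eq (f : (ops hF).endSubmonoid X) :
    ∃ (c : ℕ+) (θ : endSubmonoid F (frobPow hF X.obj c)), endSubmonoidClassHom X c θ = f := by
  obtain ⟨c, θ, hθ, h⟩ := exists_endClassHom_eq_of_mem X f.2
  exact ⟨c, ⟨θ, hθ⟩, Subtype.ext h⟩

/-- Transport does not change the class (restricted homomorphism form).
[cite: MochizukiFrdI2008, Def. 3.1 (ii) p.56] -/
theorem endSubmonoidClassHom_liftLevel {c c' : ℕ+} (h : c ∣ c') (θ : endSubmonoid F (frobPow hF X.obj c))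
    (hd : degFr F (frobTrans hF X.obj h) = degFr F (frobTrans hF X.obj h)) :
    endSubmonoidClassHom X c'
        ⟨End.of (liftLevel hF (End.asHom θ.1) h h hd), (liftLevel_mem_iff X h θ.1 hd).mpr θ.2⟩ =
      endSubmonoidClassHom X c θ :=
  Subtype.ext (endClassHom_liftLevel X h θ.1 hd)

/-! ### The image of `C → C^pf` at the level `(1, 1)` -/

/-- The image `toPf(α)` of an endomorphism `α` of `A` is the class, at the diagonal level `(1, 1)`, of the
Prop. 1.10 (i) conjugate of `α` along the chosen degree-one Frobenius-type arrow `A → A^{(1)}`.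
[cite: MochizukiFrdI2008, Def. 3.1 (iii) p.57] -/
theorem toPf_map_eq_endClass {A : C} (α : A ⟶ A) :
    (toPf hF).map α = endClass (root hF A 1) 1 (toPfRep hF α).hom := rfl

/-- Uniqueness at level `(1, 1)`: an endomorphism `θ` of `A^{(1)}` with `frob ≫ θ = α ≫ frob` represents
`toPf(α)`. [cite: MochizukiFrdI2008, Def. 3.1 (iii) p.57] -/
theorem endClass_one_eq_toPf_map {A : C} (α : A ⟶ A) (θ : frobPow hF A 1 ⟶ frobPow hF A 1)
    (h : frob hF A 1 ≫ θ = α ≫ frob hF A 1) :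
    endClass (root hF A 1) 1 θ = (toPf hF).map α := by
  rw [toPf_map_eq_endClass, conjFr_unique hF (isFrobeniusType_frob hF A 1) (isFrobeniusType_frob hF A 1)
    ((degFr_frob hF A 1).trans (degFr_frob hF A 1).symm) h]

end Perfection

end PreFrobenioid

end Literature.AlgebraicGeometry.Frobenioids
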